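import Literature.NumberTheory.LFunctions.RiemannXi
import Literature.NumberTheory.LFunctions.HuxleyZeroDetection
import Literature.NumberTheory.Transcendental.EulerTailProduct
import Literature.NumberTheory.LFunctions.XiPrimitiveProofs
import Literature.NumberTheory.LFunctions.XiStripHeightSup
import Literature.Analysis.SpecialFunctions.GammaStirlingOrder
import HarnessLib

/-!
# H-RIG along route B″ — file 2/7 of the split of `HandoffHRig` (handoff-idea-3 gen 26)

S2.R the Gamma ratio (Euler product, antitone, two bounds) + S2.X the factorisation of `ξ` on `σ ≥ 2`.
See the module docstring of `HandoffHRig.lean` (the last file) for the theorem `hRig_holds (D : ℕ) : HRig D`,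
the route B″ and the references.  Nothing in this file bears on the truth of RH. [folklore]
-/

set_option linter.dupNamespace false

noncomputable section

open Complex MeasureTheory Set Filter Asymptotics
open scoped Real Topology
open Literature.NumberTheory.LFunctions
open Literature.Analysis.SpecialFunctions (log_gammaRatio_le)
open Literature.Analysis.SpecialFunctions.GammaVert (tendsto_prod_one_add_div_sq Gamma_ne_zero_of_pos)

namespace Summit.RiemannHypothesis.RiemannHypothesis.Theorems.HandoffHRig

/-! ### S2 — exterior cost of dividing by `ξ` — PROVED (no sorry).
For `σ ≥ 2`: `ξ(s) = ½ s(s−1) π^{−s/2} Γ(s/2) ζ(s)` (`riemannXi_eq_Gamma_mul_zeta`), `|ζ(s)| ≥ 1/3`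
(`one_third_le_norm_riemannZeta`), `Γ(σ/2+D) = Γ(σ/2)·Π_{j<D}(σ/2+j)` with `Π ≤ D!(1+‖s‖)^D`
(`≤ D!(σ/2)^D` on the real axis), and the Euler product `Γ(x)²/‖Γ(x+iy)‖² = Π_{j≥0}(1 + y²/(x+j)²)`
(tree `GammaVert.tendsto_prod_one_add_div_sq`): it is ANTITONE in `x`, so the tree's bound `≤ e^{π|y|}`
on `1/2 ≤ x ≤ 3/2` (`log_gammaRatio_le`) extends to all `x ≥ 1/2` (clauses 1–2: `Γ(σ/2) ≤
e^{π|τ|/4}‖Γ(s/2)‖`), and `Π ≤ exp(Σ y²/(x+j)²) ≤ exp(y²/x² + y²/x)` (telescoping) gives, for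
`|y| ≤ αx`, `α ≤ 1`: `Γ(x) ≤ e^{1/2} e^{α|y|/2} ‖Γ(x+iy)‖` (clauses 3–4 with `α = min(4ε, 1)`);
mirror by `riemannXi_one_sub` and `(1+‖1−s‖)^D ≤ 2^D(1+‖s‖)^D`.  `K = 12·D!·2^D·e^{1/2}`. -/

/-! ### S2.R The Gamma ratio `Γ(x)²/‖Γ(x+iy)‖² = ∏ (1 + y²/(x+j)²)` : monotone in `x`, two bounds -/

/- LANDING NOTE (theory-1 gen19): idea-3 g26's `gammaRatio_anti` restated the tree's
`Literature.NumberTheory.LFunctions.HuxleyZeroDetection.gammaRatio_antitone` (gate `dedup.landed`); the landed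
lemma is imported and used below instead (identical statement). -/

/-- `Γ(x)² ≤ e^{π|y|} ‖Γ(x+iy)‖²` for all `x ≥ ½` (tree: `1/2 ≤ x ≤ 3/2`; extend by antitonicity). -/
theorem gammaRatio_le_exp_pi {x : ℝ} (hx : 1 / 2 ≤ x) (y : ℝ) :
    Real.Gamma x ^ 2 / ‖Complex.Gamma (x + y * I)‖ ^ 2 ≤ Real.exp (π * |y|) := by
  set n : ℕ := ⌊x - 1 / 2⌋₊ with hn
  have hn1 : (n : ℝ) ≤ x - 1 / 2 := Nat.floor_le (by linarith)
  have hn2 : x - 1 / 2 < n + 1 := Nat.lt_floor_add_one _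
  have hx' : 1 / 2 ≤ x - n := by linarith
  have hx'' : x - n ≤ 3 / 2 := by linarith
  have h0 : 0 < x - n := by linarith
  have hmono := Literature.NumberTheory.LFunctions.HuxleyZeroDetection.gammaRatio_antitone h0
    (by linarith : x - n ≤ x) y
  have hlog := log_gammaRatio_le hx' hx'' y
  have hpos : 0 < Real.Gamma (x - n) ^ 2 / ‖Complex.Gamma ((x - n : ℝ) + y * I)‖ ^ 2 := by
    have h1 : 0 < Real.Gamma (x - n) := Real.Gamma_pos_of_pos h0
    have h2 : 0 < ‖Complex.Gamma ((x - n : ℝ) + y * I)‖ :=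
      norm_pos_iff.mpr (Gamma_ne_zero_of_pos h0 y)
    positivity
  rw [Real.log_le_iff_le_exp hpos] at hlog
  exact hmono.trans hlog

/-- `Γ(x) ≤ e^{π|y|/2} ‖Γ(x+iy)‖` for `x ≥ ½`. -/
theorem Gamma_le_exp_mul_norm {x : ℝ} (hx : 1 / 2 ≤ x) (y : ℝ) :
    Real.Gamma x ≤ Real.exp (π * |y| / 2) * ‖Complex.Gamma (x + y * I)‖ := by
  have hx0 : 0 < x := by linarith
  have hn : 0 < ‖Complex.Gamma (x + y * I)‖ := norm_pos_iff.2 (Gamma_ne_zero_of_pos hx0 y)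
  have h := gammaRatio_le_exp_pi hx y
  rw [div_le_iff₀ (by positivity)] at h
  have hsq : Real.Gamma x ^ 2 ≤ (Real.exp (π * |y| / 2) * ‖Complex.Gamma (x + y * I)‖) ^ 2 := by
    have e : Real.exp (π * |y| / 2) ^ 2 = Real.exp (π * |y|) := by
      rw [← Real.exp_nat_mul]; congr 1; push_cast; ring
    rw [mul_pow, e]; exact h
  exact le_of_pow_le_pow_left₀ two_ne_zero (by positivity) hsq

/-- Telescoping: `∑_{j ≤ n} 1/(x+j)² ≤ 1/x² + 1/x` for `x > 0`. -/
theorem sum_inv_sq_le {x : ℝ} (hx : 0 < x) (n : ℕ) :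
    ∑ j ∈ Finset.range (n + 1), 1 / (x + j) ^ 2 ≤ 1 / x ^ 2 + 1 / x - 1 / (x + n) := by
  induction n with
  | zero => simp
  | succ n ih =>
    rw [Finset.sum_range_succ]
    have hxn : 0 < x + n := by positivity
    have hxn1 : 0 < x + (n + 1 : ℕ) := by positivity
    have hstep : 1 / (x + (n + 1 : ℕ)) ^ 2 ≤ 1 / (x + n) - 1 / (x + (n + 1 : ℕ)) := by
      rw [div_sub_div _ _ hxn.ne' hxn1.ne', div_le_div_iff₀ (by positivity) (by positivity)]
      push_cast
      nlinarith
    push_cast at hstep ih ⊢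
    linarith

/-- `Γ(x)²/‖Γ(x+iy)‖² ≤ exp(y²/x² + y²/x)` for `x > 0`. -/
theorem gammaRatio_le_exp_sq {x : ℝ} (hx : 0 < x) (y : ℝ) :
    Real.Gamma x ^ 2 / ‖Complex.Gamma (x + y * I)‖ ^ 2 ≤ Real.exp (y ^ 2 / x ^ 2 + y ^ 2 / x) := by
  refine le_of_tendsto' (tendsto_prod_one_add_div_sq hx y) fun n => ?_
  calc ∏ j ∈ Finset.range (n + 1), (1 + y ^ 2 / (x + j) ^ 2)
      ≤ ∏ j ∈ Finset.range (n + 1), Real.exp (y ^ 2 / (x + j) ^ 2) := by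
        refine Finset.prod_le_prod (fun j _ => by positivity) fun j _ => ?_
        linarith [Real.add_one_le_exp (y ^ 2 / (x + j) ^ 2)]
    _ = Real.exp (∑ j ∈ Finset.range (n + 1), y ^ 2 / (x + j) ^ 2) := by rw [Real.exp_sum]
    _ ≤ Real.exp (y ^ 2 / x ^ 2 + y ^ 2 / x) := by
        rw [Real.exp_le_exp]
        have hs := sum_inv_sq_le hx n
        have e : ∑ j ∈ Finset.range (n + 1), y ^ 2 / (x + j) ^ 2 =
            y ^ 2 * ∑ j ∈ Finset.range (n + 1), 1 / (x + j) ^ 2 := by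
          rw [Finset.mul_sum]; refine Finset.sum_congr rfl fun j _ => ?_; ring
        rw [e]
        have hxn : 0 ≤ 1 / (x + n) := by positivity
        calc y ^ 2 * ∑ j ∈ Finset.range (n + 1), 1 / (x + j) ^ 2
            ≤ y ^ 2 * (1 / x ^ 2 + 1 / x) :=
              mul_le_mul_of_nonneg_left (by linarith) (sq_nonneg y)
          _ = y ^ 2 / x ^ 2 + y ^ 2 / x := by ring

/-- Thin-sector comparison: for `x ≥ 1`, `0 ≤ α ≤ 1`, `|y| ≤ αx`:
`Γ(x) ≤ e^{1/2} e^{α|y|/2} ‖Γ(x+iy)‖`. -/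
theorem Gamma_le_exp_mul_norm_of_small {x y α : ℝ} (hx : 1 ≤ x) (hα1 : α ≤ 1)
    (hy : |y| ≤ α * x) :
    Real.Gamma x ≤ Real.exp (1 / 2) * Real.exp (α * |y| / 2) * ‖Complex.Gamma (x + y * I)‖ := by
  have hx0 : 0 < x := by linarith
  have hn : 0 < ‖Complex.Gamma (x + y * I)‖ := norm_pos_iff.2 (Gamma_ne_zero_of_pos hx0 y)
  have h := gammaRatio_le_exp_sq hx0 y
  have hb : y ^ 2 / x ^ 2 + y ^ 2 / x ≤ 1 + α * |y| := by
    have hy2 : y ^ 2 = |y| ^ 2 := (sq_abs y).symm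
    have h1 : y ^ 2 / x ^ 2 ≤ 1 := by
      rw [div_le_one (by positivity), hy2]
      have : |y| ≤ x := hy.trans (by nlinarith)
      exact pow_le_pow_left₀ (abs_nonneg y) this 2
    have h2 : y ^ 2 / x ≤ α * |y| := by
      rw [div_le_iff₀ hx0, hy2, sq]
      calc |y| * |y| ≤ |y| * (α * x) := mul_le_mul_of_nonneg_left hy (abs_nonneg y)
        _ = α * |y| * x := by ring
    linarith
  have h' : Real.Gamma x ^ 2 / ‖Complex.Gamma (x + y * I)‖ ^ 2 ≤ Real.exp (1 + α * |y|) :=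
    h.trans (Real.exp_le_exp.2 hb)
  rw [div_le_iff₀ (by positivity)] at h'
  have hsq : Real.Gamma x ^ 2 ≤
      (Real.exp (1 / 2) * Real.exp (α * |y| / 2) * ‖Complex.Gamma (x + y * I)‖) ^ 2 := by
    have e : (Real.exp (1 / 2) * Real.exp (α * |y| / 2)) ^ 2 = Real.exp (1 + α * |y|) := by
      rw [← Real.exp_add, ← Real.exp_nat_mul]; congr 1; push_cast; ring
    rw [mul_pow, e]; exact h'
  exact le_of_pow_le_pow_left₀ two_ne_zero (by positivity) hsq

/-! ### S2.X The factorisation `ξ(s) = ½s(s−1)π^{−s/2}Γ(s/2)ζ(s)` on `σ ≥ 2` and the Gamma shift -/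

/-- `‖s‖‖s−1‖/6 · π^{−σ/2}‖Γ(s/2)‖ ≤ ‖ξ(s)‖` for `σ ≥ 2` (`|ζ| ≥ 1/3` there). -/
theorem xi_norm_lower {s : ℂ} (hs : 2 ≤ s.re) :
    ‖s‖ * ‖s - 1‖ / 6 * (π ^ (-s.re / 2) * ‖Complex.Gamma (s / 2)‖) ≤ ‖riemannXi s‖ := by
  have hs1 : s ≠ 1 := fun h => by rw [h, one_re] at hs; norm_num at hs
  have hζ := one_third_le_norm_riemannZeta hs
  rw [riemannXi_eq_Gamma_mul_zeta (by linarith) hs1, norm_mul, norm_mul, norm_div, norm_mul,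
    norm_mul, Complex.norm_cpow_eq_rpow_re_of_pos Real.pi_pos]
  have hre : (-s / 2).re = -s.re / 2 := by simp [neg_div]
  rw [hre]
  have h2 : ‖(2 : ℂ)‖ = 2 := by simp
  rw [h2]
  calc ‖s‖ * ‖s - 1‖ / 6 * (π ^ (-s.re / 2) * ‖Complex.Gamma (s / 2)‖)
      = ‖s‖ * ‖s - 1‖ / 2 * (π ^ (-s.re / 2) * ‖Complex.Gamma (s / 2)‖) * (1 / 3) := by ring
    _ ≤ ‖s‖ * ‖s - 1‖ / 2 * (π ^ (-s.re / 2) * ‖Complex.Gamma (s / 2)‖) * ‖riemannZeta s‖ :=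
        mul_le_mul_of_nonneg_left hζ (by positivity)

/-- `π^{−σ/2}‖Γ(s/2)‖ ≤ 3‖ξ(s)‖` for `σ ≥ 2`. -/
theorem pi_Gamma_le_three_xi {s : ℂ} (hs : 2 ≤ s.re) :
    π ^ (-s.re / 2) * ‖Complex.Gamma (s / 2)‖ ≤ 3 * ‖riemannXi s‖ := by
  have h := xi_norm_lower hs
  have hn1 : 2 ≤ ‖s‖ := hs.trans (re_le_norm s)
  have hn2 : 1 ≤ ‖s - 1‖ := by
    have : (s - 1).re = s.re - 1 := by simp
    linarith [re_le_norm (s - 1)]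
  have hprod : 2 ≤ ‖s‖ * ‖s - 1‖ := by nlinarith
  have hX : 0 ≤ π ^ (-s.re / 2) * ‖Complex.Gamma (s / 2)‖ := by positivity
  nlinarith

/- LANDING NOTE (theory-1 gen19): idea-3 g26's `Gamma_add_nat_eq` (`Γ(x + D) = Γ(x) · ∏_{j<D} (x + j)`) restated
the tree's `Literature.NumberTheory.Transcendental.Zagier2012.Real_Gamma_add_nat` (gate `dedup.landed`); file 3
(`HandoffHRigDivisionCost`) uses the landed lemma, imported here. -/

/-- `∏_{j<D} (x + j) ≤ D! (1 + M)^D` for `0 ≤ x ≤ M`. -/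
theorem prod_le_factorial_mul_pow {x M : ℝ} (hx : 0 ≤ x) (hM : x ≤ M) (D : ℕ) :
    ∏ j ∈ Finset.range D, (x + j) ≤ D.factorial * (1 + M) ^ D := by
  calc ∏ j ∈ Finset.range D, (x + j) ≤ ∏ j ∈ Finset.range D, ((j + 1) * (1 + M)) := by
        refine Finset.prod_le_prod (fun j _ => by positivity) fun j _ => ?_
        nlinarith [(Nat.cast_nonneg j : (0:ℝ) ≤ j)]
    _ = D.factorial * (1 + M) ^ D := by
        rw [Finset.prod_mul_distrib, Finset.prod_const, Finset.card_range,
          ← Finset.prod_range_add_one_eq_factorial]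
        push_cast; ring

/-- `∏_{j<D} (x + j) ≤ D! x^D` for `x ≥ 1`. -/
theorem prod_le_factorial_mul_pow' {x : ℝ} (hx : 1 ≤ x) (D : ℕ) :
    ∏ j ∈ Finset.range D, (x + j) ≤ D.factorial * x ^ D := by
  calc ∏ j ∈ Finset.range D, (x + j) ≤ ∏ j ∈ Finset.range D, ((j + 1) * x) := by
        refine Finset.prod_le_prod (fun j _ => by positivity) fun j _ => ?_
        nlinarith [(Nat.cast_nonneg j : (0:ℝ) ≤ j)]
    _ = D.factorial * x ^ D := by
        rw [Finset.prod_mul_distrib, Finset.prod_const, Finset.card_range,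
          ← Finset.prod_range_add_one_eq_factorial]
        push_cast; ring

/-- `s/2` in real coordinates. -/
theorem half_eq (s : ℂ) : s / 2 = ((s.re / 2 : ℝ) : ℂ) + ((s.im / 2 : ℝ) : ℂ) * I := by
  apply Complex.ext <;> simp

end Summit.RiemannHypothesis.RiemannHypothesis.Theorems.HandoffHRig
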